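import Literature.Analysis.FunctionSpaces.LittlewoodPaleyKernel
import Literature.Analysis.FluidPDE.ClassicalSolutionCalculus
import HarnessLib

/-!
# Time regularity of the Littlewood–Paley block energies on an interval of regularity

Analysis/FluidPDE support file (serves the discharge of
`Literature.Analysis.FluidPDE.cheskidov_shvydkoy`, ns.S31). Cheskidov–Shvydkoy prove their
Lemma 3.2 (arXiv:0708.3067, p. 5) by "using the weak formulation of the NSE with the
test-function `λ_q^{1+ε}(u_q)_q`" on an interval of regularity, i.e. by the identity
`½ d/dt ‖u_q‖²₂ = ⟨∂ₜu, (u_q)_q⟩`. This file supplies the **kinematic half** of that identity,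
rigorously and **proved**, for a *regular slab* — a space–time field jointly smooth on
`[t₁, t₂] × E` with `v`, `∂ₜv` bounded and in `L²` uniformly in time (`IsRegularSlab`; the slices of
Leray's regular solutions have these properties, Ożański–Pooley 2018, Cor. 6.16):

* `continuousOn_blockFn_uncurry`: blocks of jointly continuous bounded fields are jointly
  continuous (dominated convergence);
* `IsRegularSlab.hasDerivAt_blockFn`: `∂ₜ(Δ̇_j v) = Δ̇_j(∂ₜ v)` at interior times (differentiation
  under the convolution integral); `hasDerivAt_norm_blockFn_sq`: `∂ₜ‖Δ̇_j v(t,x)‖² = 2⟪Δ̇_j v, Δ̇_j ∂ₜv⟫`;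
* `IsRegularSlab.integral_norm_blockFn_sq_sub_eq`:
  `∫‖Δ̇_j v(t)‖² - ∫‖Δ̇_j v(s)‖² = 2 ∫ₛᵗ ∫ ⟪Δ̇_j v, Δ̇_j ∂ₜv⟫ dx dτ` (pointwise fundamental theorem of
  calculus, then Fubini; the pairing is integrable on `(s,t) × E` by Cauchy–Schwarz and Young).

The dynamic half (substituting the Navier–Stokes equations for `∂ₜv`, integrating the viscous
term by parts and killing the pressure) is the sibling file on classical solutions.

## References

* A. Cheskidov, R. Shvydkoy, Arch. Ration. Mech. Anal. 195 (2010), proof of Lemma 3.2, (8)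
  (arXiv:0708.3067, p. 5). [CheskidovShvydkoy2010]
* W. S. Ożański, B. C. Pooley, in: PDE in Fluid Mechanics, LMS LN 452, CUP 2018, Cor. 6.16,
  Thm. 6.17 (energy equality for strong solutions by the same calculus). [OzanskiPooley2018]
-/

noncomputable section

open MeasureTheory Filter Topology Function Set intervalIntegral
open Literature.Analysis.FunctionSpaces
open scoped ENNReal NNReal RealInnerProductSpace

namespace Literature.Analysis.FluidPDE

variable {E : Type*} [NormedAddCommGroup E] [InnerProductSpace ℝ E] [FiniteDimensional ℝ E]
  [MeasurableSpace E] [BorelSpace E]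
variable {E' : Type*} [NormedAddCommGroup E'] [InnerProductSpace ℝ E']

/-- A **regular slab**: a space–time field `v` on `[t₁, t₂] × E` which is jointly smooth, with
`v` and its (one-sided at the ends) time derivative `∂ₜv = timeDerivWithin (Icc t₁ t₂) v` bounded
on the slab and square integrable in space uniformly in time — the properties of Leray's regular
solutions on a compact interval of regularity (Ożański–Pooley 2018, Cor. 6.16: `∂ₜᵏ∇ᵐu ∈
C((0,T); L² ∩ L^∞)`) that make the block energies `t ↦ ‖Δ̇_j v(t)‖²_{L²}` absolutely continuous.
[folklore] -/
structure IsRegularSlab (t₁ t₂ : ℝ) (v : ℝ → E → E') : Prop where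
  /-- `v` is jointly `C^∞` on `[t₁, t₂] × E`. -/
  smooth : IsSmoothSpaceTimeOn (Icc t₁ t₂) v
  /-- `v` is bounded on the slab. -/
  bound : ∃ C : ℝ, ∀ t ∈ Icc t₁ t₂, ∀ x, ‖v t x‖ ≤ C
  /-- `∂ₜv` is bounded on the slab. -/
  bound_dt : ∃ C : ℝ, ∀ t ∈ Icc t₁ t₂, ∀ x, ‖timeDerivWithin (Icc t₁ t₂) v t x‖ ≤ C
  /-- `‖v(t)‖_{L²}` is bounded on `[t₁, t₂]`. -/
  sq : ∃ C : ℝ≥0, ∀ t ∈ Icc t₁ t₂, ∫⁻ x, ‖v t x‖ₑ ^ 2 ≤ C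
  /-- `‖∂ₜv(t)‖_{L²}` is bounded on `[t₁, t₂]`. -/
  sq_dt : ∃ C : ℝ≥0, ∀ t ∈ Icc t₁ t₂, ∫⁻ x, ‖timeDerivWithin (Icc t₁ t₂) v t x‖ₑ ^ 2 ≤ C

namespace IsRegularSlab

variable {t₁ t₂ : ℝ} {v : ℝ → E → E'}

/-- The slices of a regular slab are continuous. [folklore] -/
theorem continuous_slice (h : IsRegularSlab t₁ t₂ v) {t : ℝ} (ht : t ∈ Icc t₁ t₂) : Continuous (v t) := by
  have hc : ContinuousOn (uncurry v) (Icc t₁ t₂ ×ˢ univ) := h.smooth.continuousOn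
  have : Continuous fun x : E => uncurry v (t, x) :=
    hc.comp_continuous (continuous_const.prodMk continuous_id) fun x => ⟨ht, mem_univ _⟩
  exact this

/-- The slices of a regular slab are square integrable. [folklore] -/
theorem memLp_slice (h : IsRegularSlab t₁ t₂ v) {t : ℝ} (ht : t ∈ Icc t₁ t₂) : MemLp (v t) 2 volume := by
  obtain ⟨C, hC⟩ := h.sq
  refine ⟨(h.continuous_slice ht).aestronglyMeasurable, ?_⟩
  rw [eLpNorm_eq_lintegral_rpow_enorm_toReal two_ne_zero ENNReal.ofNat_ne_top, ENNReal.toReal_ofNat]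
  refine ENNReal.rpow_lt_top_of_nonneg (by norm_num) (ne_of_lt ?_)
  have hlt : ∫⁻ x, ‖v t x‖ₑ ^ 2 < ∞ := (hC t ht).trans_lt ENNReal.coe_lt_top
  simpa [ENNReal.rpow_two] using hlt

/-- The time derivative of a regular slab is jointly smooth on the slab (for `t₁ < t₂`). [folklore] -/
theorem smooth_dt (h : IsRegularSlab t₁ t₂ v) (h12 : t₁ < t₂) :
    IsSmoothSpaceTimeOn (Icc t₁ t₂) (timeDerivWithin (Icc t₁ t₂) v) :=
  h.smooth.timeDerivWithin (uniqueDiffOn_Icc h12)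

/-- At interior times the slices of a regular slab are differentiable in time with derivative the
slab time derivative: `HasDerivAt (v · x) (∂ₜv t x) t` for `t ∈ (t₁, t₂)`. [folklore] -/
theorem hasDerivAt_slice (h : IsRegularSlab t₁ t₂ v) {t : ℝ} (ht : t ∈ Ioo t₁ t₂) (x : E) :
    HasDerivAt (fun s => v s x) (timeDerivWithin (Icc t₁ t₂) v t x) t := by
  have h12 : t₁ < t₂ := ht.1.trans ht.2
  have ht' : t ∈ Icc t₁ t₂ := Ioo_subset_Icc_self ht
  have hd := (h.smooth.hasDerivWithinAt_time ht' x).hasDerivAt (Icc_mem_nhds ht.1 ht.2)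
  rwa [← h.smooth.timeDerivWithin_eq (uniqueDiffOn_Icc h12) ht' x] at hd

end IsRegularSlab

/-! ## Blocks of jointly continuous bounded space–time fields -/

section Continuity

/-- **Blocks of a jointly continuous bounded field are jointly continuous** on the slab
(dominated convergence in `∫ K_j(y) w(t, x - y) dy`, dominated by `sup ‖w‖ · |K_j|`). [folklore] -/
theorem continuousOn_blockFn_uncurry {S : Set ℝ} {w : ℝ → E → E'} (hc : ContinuousOn (uncurry w) (S ×ˢ univ))
    {M : ℝ} (hM : ∀ t ∈ S, ∀ x, ‖w t x‖ ≤ M) (j : ℤ) :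
    ContinuousOn (fun z : ℝ × E => blockFn j (w z.1) z.2) (S ×ˢ univ) := by
  have hrepr : (fun z : ℝ × E => blockFn j (w z.1) z.2) =
      fun z => ∫ y, blockKernel E j y • w z.1 (z.2 - y) := by
    funext z; rw [blockFn_apply]
  rw [hrepr]
  refine continuousOn_of_dominated (bound := fun y => ‖blockKernel E j y‖ * M) ?_ ?_ ?_ ?_
  · intro z hz
    have hslice : Continuous (w z.1) := by
      have : Continuous fun x : E => uncurry w (z.1, x) :=
        hc.comp_continuous (continuous_const.prodMk continuous_id) fun x => ⟨hz.1, mem_univ _⟩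
      exact this
    exact (continuous_blockKernel j).aestronglyMeasurable.smul
      (hslice.aestronglyMeasurable.comp_measurePreserving (Measure.measurePreserving_sub_left volume z.2))
  · intro z hz
    refine Eventually.of_forall fun y => ?_
    rw [norm_smul]
    exact mul_le_mul_of_nonneg_left (hM z.1 hz.1 _) (norm_nonneg _)
  · exact (integrable_blockKernel j).norm.mul_const M
  · refine Eventually.of_forall fun y => ?_
    have h1 : ContinuousOn (fun z : ℝ × E => uncurry w (z.1, z.2 - y)) (S ×ˢ univ) :=
      hc.comp (continuousOn_fst.prodMk (continuousOn_snd.sub continuousOn_const))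
        fun z hz => ⟨hz.1, mem_univ _⟩
    exact ((continuousOn_const (c := blockKernel E j y)).smul h1 :)

/-- The slices version: for `t ∈ S`, `x ↦ Δ̇_j (w t)` composed with the slab map is continuous on
`S` in `t` for fixed `x`. [folklore] -/
theorem continuousOn_blockFn_time {S : Set ℝ} {w : ℝ → E → E'} (hc : ContinuousOn (uncurry w) (S ×ˢ univ))
    {M : ℝ} (hM : ∀ t ∈ S, ∀ x, ‖w t x‖ ≤ M) (j : ℤ) (x : E) :
    ContinuousOn (fun t => blockFn j (w t) x) S :=
  (continuousOn_blockFn_uncurry hc hM j).comp (continuousOn_id.prodMk continuousOn_const)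
    fun _ ht => ⟨ht, mem_univ _⟩

end Continuity

/-! ## Time derivative of the blocks of a regular slab -/

namespace IsRegularSlab

variable {t₁ t₂ : ℝ} {v : ℝ → E → E'}

/-- **The blocks of a regular slab are differentiable in time at interior times, with
`∂ₜ(Δ̇_j v)(t, x) = Δ̇_j(∂ₜv)(t, x)`** (differentiation under `∫ K_j(y) v(t, x - y) dy`, dominated by
`sup ‖∂ₜv‖ · |K_j|`; the mean value theorem supplies the domination on a neighbourhood). [folklore] -/
theorem hasDerivAt_blockFn (h : IsRegularSlab t₁ t₂ v) (j : ℤ) {t : ℝ} (ht : t ∈ Ioo t₁ t₂) (x : E) :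
    HasDerivAt (fun s => blockFn j (v s) x) (blockFn j (timeDerivWithin (Icc t₁ t₂) v t) x) t := by
  obtain ⟨M, hM⟩ := h.bound_dt
  obtain ⟨M₀, hM₀⟩ := h.bound
  have hIoo : Ioo t₁ t₂ ∈ 𝓝 t := Ioo_mem_nhds ht.1 ht.2
  simp only [blockFn_apply]
  have key := hasDerivAt_integral_of_dominated_loc_of_deriv_le (μ := (volume : Measure E)) (𝕜 := ℝ)
    (F := fun s y => blockKernel E j y • v s (x - y))
    (F' := fun s y => blockKernel E j y • timeDerivWithin (Icc t₁ t₂) v s (x - y)) (x₀ := t)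
    (bound := fun y => ‖blockKernel E j y‖ * M) (s := Ioo t₁ t₂) hIoo ?_ ?_ ?_ ?_ ?_ ?_
  · exact key.2
  · filter_upwards [hIoo] with s hs
    exact (continuous_blockKernel j).aestronglyMeasurable.smul
      ((h.continuous_slice (Ioo_subset_Icc_self hs)).aestronglyMeasurable.comp_measurePreserving
        (Measure.measurePreserving_sub_left volume x))
  · exact integrable_blockKernel_smul_sub_of_bound j (h.continuous_slice (Ioo_subset_Icc_self ht)).aestronglyMeasurable
      (hM₀ t (Ioo_subset_Icc_self ht)) x
  · have h12 : t₁ < t₂ := ht.1.trans ht.2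
    have hc : ContinuousOn (uncurry (timeDerivWithin (Icc t₁ t₂) v)) (Icc t₁ t₂ ×ˢ univ) :=
      (h.smooth_dt h12).continuousOn
    have hslice : Continuous (timeDerivWithin (Icc t₁ t₂) v t) := by
      have : Continuous fun y : E => uncurry (timeDerivWithin (Icc t₁ t₂) v) (t, y) :=
        hc.comp_continuous (continuous_const.prodMk continuous_id) fun y => ⟨Ioo_subset_Icc_self ht, mem_univ _⟩
      exact this
    exact (continuous_blockKernel j).aestronglyMeasurable.smul
      (hslice.aestronglyMeasurable.comp_measurePreserving (Measure.measurePreserving_sub_left volume x))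
  · refine Eventually.of_forall fun y s hs => ?_
    rw [norm_smul]
    exact mul_le_mul_of_nonneg_left (hM s (Ioo_subset_Icc_self hs) _) (norm_nonneg _)
  · exact (integrable_blockKernel j).norm.mul_const M
  · refine Eventually.of_forall fun y s hs => ?_
    exact (h.hasDerivAt_slice hs (x - y)).const_smul (blockKernel E j y)

/-- **The pointwise block energy is differentiable in time** at interior times:
`∂ₜ ‖Δ̇_j v(t, x)‖² = 2 ⟪Δ̇_j v(t, x), Δ̇_j(∂ₜv)(t, x)⟫`. [folklore] -/
theorem hasDerivAt_norm_blockFn_sq (h : IsRegularSlab t₁ t₂ v) (j : ℤ) {t : ℝ} (ht : t ∈ Ioo t₁ t₂) (x : E) :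
    HasDerivAt (fun s => ‖blockFn j (v s) x‖ ^ 2)
      (2 * ⟪blockFn j (v t) x, blockFn j (timeDerivWithin (Icc t₁ t₂) v t) x⟫) t :=
  (h.hasDerivAt_blockFn j ht x).norm_sq

/-! ## The block energy is absolutely continuous: `‖Δ̇_j v(t)‖² - ‖Δ̇_j v(s)‖² = 2 ∫ₛᵗ ⟨Δ̇_j v, Δ̇_j ∂ₜv⟩` -/

/-- The blocks of the slices are square integrable, with a bound uniform in time:
`∫⁻ ‖Δ̇_j v(t)‖ₑ² ≤ ‖K_j‖₁² C` if `∫⁻ ‖v(t)‖ₑ² ≤ C`. [folklore] -/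
theorem lintegral_blockFn_sq_le {w : ℝ → E → E'} {S : Set ℝ} {C : ℝ≥0}
    (hw : ∀ t ∈ S, AEStronglyMeasurable (w t) volume) (hC : ∀ t ∈ S, ∫⁻ x, ‖w t x‖ₑ ^ 2 ≤ C) (j : ℤ)
    {t : ℝ} (ht : t ∈ S) :
    ∫⁻ x, ‖blockFn j (w t) x‖ₑ ^ 2 ≤ (∫⁻ y, ‖blockKernel E j y‖ₑ) ^ 2 * C := by
  have h1 := eLpNorm_blockFn_le j (hw t ht) one_le_two (v := w t)
  have hsq : ∀ f : E → E', eLpNorm f 2 (volume : Measure E) ^ 2 = ∫⁻ x, ‖f x‖ₑ ^ 2 := fun f => by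
    rw [eLpNorm_eq_lintegral_rpow_enorm_toReal two_ne_zero ENNReal.ofNat_ne_top, ENNReal.toReal_ofNat,
      ← ENNReal.rpow_natCast, ← ENNReal.rpow_mul]
    norm_num
  calc ∫⁻ x, ‖blockFn j (w t) x‖ₑ ^ 2 = eLpNorm (blockFn j (w t)) 2 volume ^ 2 := (hsq _).symm
    _ ≤ ((∫⁻ y, ‖blockKernel E j y‖ₑ) * eLpNorm (w t) 2 volume) ^ 2 := pow_le_pow_left' h1 2
    _ = (∫⁻ y, ‖blockKernel E j y‖ₑ) ^ 2 * eLpNorm (w t) 2 volume ^ 2 := mul_pow _ _ _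
    _ ≤ (∫⁻ y, ‖blockKernel E j y‖ₑ) ^ 2 * C := by rw [hsq]; gcongr; exact hC t ht

/-- Cauchy–Schwarz for the pairing of two blocks: `∫⁻ ‖⟪a, b⟫‖ₑ ≤ (∫⁻ ‖a‖ₑ²)^{1/2} (∫⁻ ‖b‖ₑ²)^{1/2}`.
[folklore] -/
theorem lintegral_enorm_inner_le {a b : E → E'} (ha : AEStronglyMeasurable a volume)
    (hb : AEStronglyMeasurable b volume) :
    ∫⁻ x, ‖⟪a x, b x⟫‖ₑ ≤ (∫⁻ x, ‖a x‖ₑ ^ 2) ^ (1 / 2 : ℝ) * (∫⁻ x, ‖b x‖ₑ ^ 2) ^ (1 / 2 : ℝ) := by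
  have h1 : ∀ x, ‖⟪a x, b x⟫‖ₑ ≤ ‖a x‖ₑ * ‖b x‖ₑ := fun x => by
    rw [← ofReal_norm, ← ofReal_norm, ← ofReal_norm, ← ENNReal.ofReal_mul (norm_nonneg _)]
    exact ENNReal.ofReal_le_ofReal (norm_inner_le_norm _ _)
  refine (lintegral_mono h1).trans ?_
  have h2 := ENNReal.lintegral_mul_le_Lp_mul_Lq (volume : Measure E) Real.HolderConjugate.two_two
    ha.enorm hb.enorm
  simp only [Pi.mul_apply, ENNReal.rpow_two] at h2
  simpa using h2

/-- **The block energy identity, kinematic part.** For a regular slab `v` on `[t₁, t₂] × E` and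
`t₁ ≤ s ≤ t ≤ t₂`,
`∫ ‖Δ̇_j v(t)‖² - ∫ ‖Δ̇_j v(s)‖² = 2 ∫ₛᵗ ∫ ⟪Δ̇_j v(τ), Δ̇_j(∂ₜv)(τ)⟫ dx dτ`:
the pointwise energies are `C¹` in time (`hasDerivAt_norm_blockFn_sq`), the fundamental theorem of
calculus applies for each `x`, and Fubini exchanges the integrals (the integrand is jointly
continuous and bounded in `L¹(E)` uniformly in time by Cauchy–Schwarz and Young). This is the
justification of "`½ d/dt ‖u_q‖²₂ = ⟨∂ₜ u, (u_q)_q⟩`" behind Cheskidov–Shvydkoy's (8) on an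
interval of regularity (arXiv:0708.3067, p. 5). [folklore] -/
theorem integral_norm_blockFn_sq_sub_eq (h : IsRegularSlab t₁ t₂ v) (j : ℤ) {s t : ℝ} (hs : t₁ ≤ s)
    (hst : s ≤ t) (ht : t ≤ t₂) :
    (∫ x, ‖blockFn j (v t) x‖ ^ 2) - ∫ x, ‖blockFn j (v s) x‖ ^ 2 =
      2 * ∫ τ in s..t, ∫ x, ⟪blockFn j (v τ) x, blockFn j (timeDerivWithin (Icc t₁ t₂) v τ) x⟫ := by
  classical
  rcases eq_or_lt_of_le hst with rfl | hst'
  · simp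
  have h12 : t₁ < t₂ := lt_of_le_of_lt hs (hst'.trans_le ht)
  set w : ℝ → E → E' := fun τ => blockFn j (v τ) with hw
  set dw : ℝ → E → E' := fun τ => blockFn j (timeDerivWithin (Icc t₁ t₂) v τ) with hdw
  obtain ⟨M₀, hM₀⟩ := h.bound
  obtain ⟨M₁, hM₁⟩ := h.bound_dt
  obtain ⟨C₀, hC₀⟩ := h.sq
  obtain ⟨C₁, hC₁⟩ := h.sq_dt
  have hsub : Icc s t ⊆ Icc t₁ t₂ := Icc_subset_Icc hs ht
  -- joint continuity of `w`, `dw` on the slab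
  have hwc : ContinuousOn (fun z : ℝ × E => w z.1 z.2) (Icc t₁ t₂ ×ˢ univ) :=
    continuousOn_blockFn_uncurry h.smooth.continuousOn hM₀ j
  have hdwc : ContinuousOn (fun z : ℝ × E => dw z.1 z.2) (Icc t₁ t₂ ×ˢ univ) :=
    continuousOn_blockFn_uncurry (h.smooth_dt h12).continuousOn hM₁ j
  -- slices
  have hws : ∀ τ ∈ Icc t₁ t₂, Continuous (w τ) := fun τ hτ => by
    have : Continuous fun x : E => (fun z : ℝ × E => w z.1 z.2) (τ, x) :=
      hwc.comp_continuous (continuous_const.prodMk continuous_id) fun x => ⟨hτ, mem_univ _⟩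
    exact this
  have hdws : ∀ τ ∈ Icc t₁ t₂, Continuous (dw τ) := fun τ hτ => by
    have : Continuous fun x : E => (fun z : ℝ × E => dw z.1 z.2) (τ, x) :=
      hdwc.comp_continuous (continuous_const.prodMk continuous_id) fun x => ⟨hτ, mem_univ _⟩
    exact this
  -- uniform `L²` bounds
  set K : ℝ≥0∞ := (∫⁻ y, ‖blockKernel E j y‖ₑ) with hK
  have hKtop : K ≠ ∞ := (integrable_blockKernel j).2.ne
  have hw2 : ∀ τ ∈ Icc t₁ t₂, ∫⁻ x, ‖w τ x‖ₑ ^ 2 ≤ K ^ 2 * C₀ := fun τ hτ =>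
    lintegral_blockFn_sq_le (fun τ hτ => (h.continuous_slice hτ).aestronglyMeasurable) hC₀ j hτ
  have hdslice : ∀ τ ∈ Icc t₁ t₂, Continuous (timeDerivWithin (Icc t₁ t₂) v τ) := fun τ hτ => by
    have : Continuous fun x : E => uncurry (timeDerivWithin (Icc t₁ t₂) v) (τ, x) :=
      (h.smooth_dt h12).continuousOn.comp_continuous (continuous_const.prodMk continuous_id)
        fun x => ⟨hτ, mem_univ _⟩
    exact this
  have hdw2 : ∀ τ ∈ Icc t₁ t₂, ∫⁻ x, ‖dw τ x‖ₑ ^ 2 ≤ K ^ 2 * C₁ := fun τ hτ =>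
    lintegral_blockFn_sq_le (fun τ hτ => (hdslice τ hτ).aestronglyMeasurable) hC₁ j hτ
  -- the pairing `G(τ, x) = ⟪w, dw⟫` is integrable on `(s, t) × E`
  set G : ℝ × E → ℝ := fun z => ⟪w z.1 z.2, dw z.1 z.2⟫ with hG
  have hGc : ContinuousOn G (Icc s t ×ˢ univ) :=
    ((hwc.mono (prod_mono hsub Subset.rfl)).inner (hdwc.mono (prod_mono hsub Subset.rfl)))
  have hGslice : ∀ τ ∈ Icc s t, ∫⁻ x, ‖G (τ, x)‖ₑ ≤ (K ^ 2 * C₀) ^ (1 / 2 : ℝ) * (K ^ 2 * C₁) ^ (1 / 2 : ℝ) := by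
    intro τ hτ
    refine (lintegral_enorm_inner_le (hws τ (hsub hτ)).aestronglyMeasurable
      (hdws τ (hsub hτ)).aestronglyMeasurable).trans ?_
    gcongr
    · exact hw2 τ (hsub hτ)
    · exact hdw2 τ (hsub hτ)
  have hGint : Integrable G ((volume.restrict (Ioo s t)).prod volume) := by
    refine integrable_prod_of_continuousOn_of_lintegral hGc ?_
    calc ∫⁻ τ in Ioo s t, ∫⁻ x, ‖G (τ, x)‖ₑ
        ≤ ∫⁻ τ in Ioo s t, (K ^ 2 * C₀) ^ (1 / 2 : ℝ) * (K ^ 2 * C₁) ^ (1 / 2 : ℝ) := by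
          refine setLIntegral_mono measurable_const fun τ hτ => hGslice τ (Ioo_subset_Icc_self hτ)
      _ < ⊤ := by
          rw [setLIntegral_const, Real.volume_Ioo]
          refine ENNReal.mul_lt_top (ENNReal.mul_lt_top ?_ ?_) ENNReal.ofReal_lt_top
          · exact ENNReal.rpow_lt_top_of_nonneg (by norm_num)
              (ENNReal.mul_ne_top (ENNReal.pow_ne_top hKtop) ENNReal.coe_ne_top)
          · exact ENNReal.rpow_lt_top_of_nonneg (by norm_num)
              (ENNReal.mul_ne_top (ENNReal.pow_ne_top hKtop) ENNReal.coe_ne_top)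
  -- pointwise fundamental theorem of calculus on `[s, t]`
  have hFTC : ∀ x, ‖w t x‖ ^ 2 - ‖w s x‖ ^ 2 = ∫ τ in s..t, 2 * G (τ, x) := by
    intro x
    symm
    refine integral_eq_sub_of_hasDerivAt_of_le hst (f := fun τ => ‖w τ x‖ ^ 2) ?_ ?_ ?_
    · have hc : ContinuousOn (fun τ => w τ x) (Icc s t) :=
        (continuousOn_blockFn_time h.smooth.continuousOn hM₀ j x).mono hsub
      exact (hc.norm.pow 2)
    · intro τ hτ
      exact h.hasDerivAt_norm_blockFn_sq j ⟨lt_of_le_of_lt hs hτ.1, lt_of_lt_of_le hτ.2 ht⟩ x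
    · have hc : ContinuousOn (fun τ => 2 * G (τ, x)) (Icc s t) :=
        continuousOn_const.mul (hGc.comp (continuousOn_id.prodMk continuousOn_const)
          fun τ hτ => ⟨hτ, mem_univ _⟩)
      exact (hc.intervalIntegrable_of_Icc hst)
  -- integrability of the slice energies
  have hmem : ∀ {f : E → E'}, Continuous f → ∫⁻ x, ‖f x‖ₑ ^ 2 ≤ K ^ 2 * C₀ ∨ ∫⁻ x, ‖f x‖ₑ ^ 2 ≤ K ^ 2 * C₁ →
      Integrable (fun x => ‖f x‖ ^ 2) volume := by
    intro f hf hb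
    have hlt : ∫⁻ x, ‖f x‖ₑ ^ 2 < ∞ := by
      rcases hb with hb | hb
      · exact hb.trans_lt (ENNReal.mul_lt_top (ENNReal.pow_lt_top hKtop.lt_top) ENNReal.coe_lt_top)
      · exact hb.trans_lt (ENNReal.mul_lt_top (ENNReal.pow_lt_top hKtop.lt_top) ENNReal.coe_lt_top)
    have hmem : MemLp f 2 (volume : Measure E) := by
      refine ⟨hf.aestronglyMeasurable, ?_⟩
      rw [eLpNorm_eq_lintegral_rpow_enorm_toReal two_ne_zero ENNReal.ofNat_ne_top, ENNReal.toReal_ofNat]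
      refine ENNReal.rpow_lt_top_of_nonneg (by norm_num) (ne_of_lt ?_)
      simpa [ENNReal.rpow_two] using hlt
    exact (memLp_two_iff_integrable_sq_norm hf.aestronglyMeasurable).1 hmem
  have hIt : Integrable (fun x => ‖w t x‖ ^ 2) volume :=
    hmem (hws t ⟨hs.trans hst, ht⟩) (Or.inl (hw2 t ⟨hs.trans hst, ht⟩))
  have hIs : Integrable (fun x => ‖w s x‖ ^ 2) volume :=
    hmem (hws s ⟨hs, hst.trans ht⟩) (Or.inl (hw2 s ⟨hs, hst.trans ht⟩))
  -- Fubini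
  have hswap := integral_integral_swap (μ := volume.restrict (Ioo s t)) (ν := (volume : Measure E))
    (f := fun τ x => 2 * G (τ, x)) (by
      have := hGint.const_mul 2
      exact this)
  calc (∫ x, ‖w t x‖ ^ 2) - ∫ x, ‖w s x‖ ^ 2
      = ∫ x, (‖w t x‖ ^ 2 - ‖w s x‖ ^ 2) := (integral_sub hIt hIs).symm
    _ = ∫ x, ∫ τ in s..t, 2 * G (τ, x) := integral_congr_ae (Eventually.of_forall hFTC)
    _ = ∫ x, ∫ τ in Ioo s t, 2 * G (τ, x) := by
        refine integral_congr_ae (Eventually.of_forall fun x => ?_)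
        simp only
        rw [intervalIntegral.integral_of_le hst, integral_Ioc_eq_integral_Ioo]
    _ = ∫ τ in Ioo s t, ∫ x, 2 * G (τ, x) := hswap.symm
    _ = ∫ τ in Ioo s t, 2 * ∫ x, G (τ, x) := by
        refine integral_congr_ae (Eventually.of_forall fun τ => ?_)
        exact MeasureTheory.integral_const_mul _ _
    _ = 2 * ∫ τ in s..t, ∫ x, G (τ, x) := by
        rw [MeasureTheory.integral_const_mul, intervalIntegral.integral_of_le hst,
          integral_Ioc_eq_integral_Ioo]

end IsRegularSlab

end Literature.Analysis.FluidPDE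

end
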